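import Summits.ValiantsHypothesis.ValiantsHypothesis.Theorems.KPlusLogSqLawTropicalCycleMonotone
import Summits.ValiantsHypothesis.ValiantsHypothesis.Theorems.KPlusLogSqLawTropicalBSumset
import Summits.ValiantsHypothesis.ValiantsHypothesis.Theorems.KPlusLogSqLawTropicalBSplitDefs
import Summits.ValiantsHypothesis.ValiantsHypothesis.Theorems.LacunarySymmetroidMatrixDescartesCensusTropicalKLawStatic

/-!
# Route «KPlusLogSqLaw», crux `TropicalB` (stmt-ValiantsHypothesis-19771) — the ATOM BUDGET LAW:
# composite steps of a dominant chain are paid from the slope budget; counting-tight chains move one orbit at a time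

HONEST FRAMING.  Helper toward the registered stub `stub_tropThin` (⟺ `TropicalB`, OPEN) of `Cruxes/TropicalB/Lines/birth.lean`
(crux `Summit.ValiantsHypothesis.ValiantsHypothesis.Theses.KPlusLogSqLaw.TropicalB`, item `stmt-ValiantsHypothesis-19771`, route
`KPlusLogSqLaw`; cell `pub-symmetroid`, seat val-sym-trop-p1 g13, 2026-08-27; `--supports … --as helper`).  A STRUCTURE law valid for every
dominance design at every format, with no hypothesis on exponents, valuations, support or signs; it refines slope counting by a term that
counts PERMUTATION/CLASS structure of the steps.  Nothing here bounds `TropicalB` in its window or bears on `WeakLifting`, DoorA26 / DoorA34,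
`MatrixDescartes` (stmt-ValiantsHypothesis-18050) or VP ≠ VNP.

THE LAW.  Call the step `p → q` between two dominant terms (`p` at `θ₁`, `q` at `θ₂ > θ₁`) COMPOSITE if some column set `T` invariant under
the quotient `σ_p⁻¹ σ_q` (a union of its orbits) separates the changes: the two terms differ somewhere on `T` AND somewhere off `T`;
otherwise ATOMIC (all changed columns lie in ONE orbit of `σ_p⁻¹σ_q`, classes and rows frozen off it — a single cycle carrying its
re-classings, or `σ_p = σ_q` with exactly one column re-classed).
* `exists_present_slope_between` — a composite step has a PRESENT hybrid term (`q` on `T`, `p` off `T`) whose slope lies STRICTLY between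
  `slope p` and `slope q` (both blocks gain exponent mass: the tree's `sum_d_lt_of_isDominant_split`, p437800 lineage).
* `chain_add_card_le_card_slopeSet` — **ATOM BUDGET**: along a dominant chain `p₀ ≺ … ≺ pₙ` (distinct consecutive terms),
  `n + 1 + #{composite steps} ≤ #slopeSet m d` (the hybrids' slopes are achievable slopes in the pairwise disjoint open gaps
  `(slope p_k, slope p_{k+1})`, none of which contains a chain slope); with `card_slopeSet_le_multichoose`:
  `n + 1 + #{composite steps} ≤ multichoose K m = C(m+K−1, m)`.  Signed form `chain_add_card_le_card_slopeSet_alt`.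
* `atomic_of_card_slopeSet_le` — **COUNTING-TIGHT CHAINS ARE ATOMIC**: if the chain exhausts the slope budget (`#slopeSet m d ≤ n + 1`, e.g. the
  tree's counting-tight censuses `(3,4) = 19`, `(4,4) = 34`, `T(m,3) = C(m+2,2) − 1` rows), then EVERY step moves exactly one orbit:
  for every invariant `T` the two consecutive terms agree on `T` or agree off `T`.  Local form `atomic_of_no_slope_between` (no present term
  with slope strictly inside the gap ⇒ atomic).
READING (construction side, fork lane D2): a search for FULL chains (all `C(m+K−1,m)` histograms) may restrict successors to single-orbit
steps without loss; a chain missing `s` achievable slopes has at most `s` composite steps.  [exchange argument: folklore; packaging: this cell]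
-/

set_option linter.dupNamespace false
set_option autoImplicit false

namespace Summit.ValiantsHypothesis.ValiantsHypothesis.Theorems.KPlusLogSqLaw.AtomBudget

open Summit.ValiantsHypothesis.ValiantsHypothesis.Theorems.MatrixDescartes.Negative
open Summit.ValiantsHypothesis.ValiantsHypothesis.Theorems.LacunarySymmetroidMatrixDescartes
open Summit.ValiantsHypothesis.ValiantsHypothesis.Theorems.LacunarySymmetroidMatrixDescartes.TropicalCensus
open Summit.ValiantsHypothesis.ValiantsHypothesis.Theorems.KPlusLogSqLaw.Sumset
open scoped BigOperators
open Finset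

variable {m K : ℕ}

/-- **Slope counting in sumset form**: the achievable slopes number at most `multichoose K m = C(m+K−1, m)` (a slope only depends on
the class multiset). [folklore] -/
theorem card_slopeSet_le_multichoose (d : Fin K → ℕ) : (slopeSet m d).card ≤ Nat.multichoose K m := by
  classical
  have hsub : slopeSet m d ⊆ (univ : Finset (Sym (Fin K) m)).image
      (fun s : Sym (Fin K) m => (((s : Multiset (Fin K)).map fun l => (d l : ℤ))).sum) := by
    intro s hs
    obtain ⟨lam, rfl⟩ := mem_slopeSet.mp hs
    refine mem_image.mpr ⟨classSym ((1 : Equiv.Perm (Fin m)), lam), mem_univ _, ?_⟩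
    have h := slope_eq_of_classSym d ((1 : Equiv.Perm (Fin m)), lam)
    unfold TropicalCensus.slope at h
    exact h.symm
  calc (slopeSet m d).card
      ≤ ((univ : Finset (Sym (Fin K) m)).image
          (fun s : Sym (Fin K) m => (((s : Multiset (Fin K)).map fun l => (d l : ℤ))).sum)).card := card_le_card hsub
    _ ≤ (univ : Finset (Sym (Fin K) m)).card := card_image_le
    _ = Nat.multichoose K m := by rw [card_univ, Sym.card_sym_eq_multichoose, Fintype.card_fin]

/-- a term all of whose cells are present incidences is present. [folklore] -/
theorem termSign_ne_zero_of_cells (ε : Fin m → Fin m → Fin K → ℤ) (p : Equiv.Perm (Fin m) × (Fin m → Fin K))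
    (h : ∀ b, ε (p.1 b) b (p.2 b) ≠ 0) : termSign ε p ≠ 0 := by
  unfold termSign
  refine mul_ne_zero (Units.ne_zero _) ?_
  rw [Finset.prod_ne_zero_iff]
  exact fun b _ => h b

/-- **HYBRID OF A COMPOSITE STEP.**  If `p` is dominant at `θ₁`, `q` at `θ₂ > θ₁`, and an invariant column set `T` of `σ_p⁻¹σ_q`
separates the changes (the terms differ on `T` and off `T`), then the hybrid term carrying `q`'s (row, class) data on `T` and `p`'s
off `T` is PRESENT and its slope lies strictly between `slope p` and `slope q`. [exchange argument; this packaging is the cell's] -/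
theorem exists_present_slope_between (d : Fin K → ℕ) (v ε : Fin m → Fin m → Fin K → ℤ) {θ₁ θ₂ : ℤ} (hθ : θ₁ < θ₂)
    {p q : Equiv.Perm (Fin m) × (Fin m → Fin K)} (hp : IsDominant d v ε θ₁ p) (hq : IsDominant d v ε θ₂ q)
    (T : Finset (Fin m)) (hT : ∀ b, (p.1⁻¹ * q.1) b ∈ T ↔ b ∈ T)
    (hin : ∃ b ∈ T, p.1 b ≠ q.1 b ∨ p.2 b ≠ q.2 b) (hout : ∃ b ∉ T, p.1 b ≠ q.1 b ∨ p.2 b ≠ q.2 b) :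
    ∃ r : Equiv.Perm (Fin m) × (Fin m → Fin K), termSign ε r ≠ 0 ∧
      (∀ b ∈ T, r.1 b = q.1 b ∧ r.2 b = q.2 b) ∧ (∀ b ∉ T, r.1 b = p.1 b ∧ r.2 b = p.2 b) ∧
      TropicalCensus.slope d p < TropicalCensus.slope d r ∧ TropicalCensus.slope d r < TropicalCensus.slope d q := by
  classical
  obtain ⟨σ₁, l₁⟩ := p
  obtain ⟨σ₂, l₂⟩ := q
  obtain ⟨hlt, hltc⟩ := sum_d_lt_of_isDominant_split d v ε hθ hp hq T hT hin hout
  obtain ⟨πT, hπT, hπT', -⟩ := exists_perm_restrict (σ₁⁻¹ * σ₂) T hT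
  have hp₁ := present_of_termSign_ne_zero ε _ hp.1
  have hq₁ := present_of_termSign_ne_zero ε _ hq.1
  -- the hybrid
  have hrT : ∀ b ∈ T, (σ₁ * πT) b = σ₂ b := fun b hb => by
    rw [Equiv.Perm.mul_apply, hπT b hb]; simp
  have hrT' : ∀ b ∉ T, (σ₁ * πT) b = σ₁ b := fun b hb => by
    rw [Equiv.Perm.mul_apply, hπT' b hb]
  refine ⟨(σ₁ * πT, fun b => if b ∈ T then l₂ b else l₁ b), ?_, ?_, ?_, ?_⟩
  · refine termSign_ne_zero_of_cells ε _ fun b => ?_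
    by_cases hb : b ∈ T
    · simp only [hrT b hb, if_pos hb]; exact hq₁ b
    · simp only [hrT' b hb, if_neg hb]; exact hp₁ b
  · exact fun b hb => ⟨hrT b hb, by simp only [if_pos hb]⟩
  · exact fun b hb => ⟨hrT' b hb, by simp only [if_neg hb]⟩
  · -- slopes: split every sum over `T` and `Tᶜ`
    have sr : TropicalCensus.slope d (σ₁ * πT, fun b => if b ∈ T then l₂ b else l₁ b)
        = ∑ b ∈ T, (d (l₂ b) : ℤ) + ∑ b ∈ Tᶜ, (d (l₁ b) : ℤ) := by
      unfold TropicalCensus.slope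
      rw [← Finset.sum_add_sum_compl T]
      congr 1
      · exact Finset.sum_congr rfl fun b hb => by simp only [if_pos hb]
      · exact Finset.sum_congr rfl fun b hb => by simp only [if_neg (Finset.mem_compl.mp hb)]
    have sp : TropicalCensus.slope d (σ₁, l₁) = ∑ b ∈ T, (d (l₁ b) : ℤ) + ∑ b ∈ Tᶜ, (d (l₁ b) : ℤ) := by
      unfold TropicalCensus.slope; exact (Finset.sum_add_sum_compl T _).symm
    have sq : TropicalCensus.slope d (σ₂, l₂) = ∑ b ∈ T, (d (l₂ b) : ℤ) + ∑ b ∈ Tᶜ, (d (l₂ b) : ℤ) := by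
      unfold TropicalCensus.slope; exact (Finset.sum_add_sum_compl T _).symm
    rw [sr, sp, sq]
    exact ⟨by linarith, by linarith⟩

/-- **ATOMIC STEPS (local form).**  If no PRESENT term has slope strictly between the slopes of two consecutive dominant terms
`p ≺ q`, then the step is atomic: for every invariant `T` of `σ_p⁻¹σ_q` the two terms agree on `T` or agree off `T`. -/
theorem atomic_of_no_slope_between (d : Fin K → ℕ) (v ε : Fin m → Fin m → Fin K → ℤ) {θ₁ θ₂ : ℤ} (hθ : θ₁ < θ₂)
    {p q : Equiv.Perm (Fin m) × (Fin m → Fin K)} (hp : IsDominant d v ε θ₁ p) (hq : IsDominant d v ε θ₂ q)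
    (hgap : ∀ r : Equiv.Perm (Fin m) × (Fin m → Fin K), termSign ε r ≠ 0 → ¬ (TropicalCensus.slope d p < TropicalCensus.slope d r ∧ TropicalCensus.slope d r < TropicalCensus.slope d q))
    (T : Finset (Fin m)) (hT : ∀ b, (p.1⁻¹ * q.1) b ∈ T ↔ b ∈ T) :
    (∀ b ∈ T, p.1 b = q.1 b ∧ p.2 b = q.2 b) ∨ (∀ b ∉ T, p.1 b = q.1 b ∧ p.2 b = q.2 b) := by
  by_contra h
  rw [not_or] at h
  obtain ⟨h1, h2⟩ := h
  have hin : ∃ b ∈ T, p.1 b ≠ q.1 b ∨ p.2 b ≠ q.2 b := by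
    by_contra hc; push Not at hc; exact h1 fun b hb => hc b hb
  have hout : ∃ b ∉ T, p.1 b ≠ q.1 b ∨ p.2 b ≠ q.2 b := by
    by_contra hc; push Not at hc; exact h2 fun b hb => hc b hb
  obtain ⟨r, hr, -, -, h₁, h₂⟩ := exists_present_slope_between d v ε hθ hp hq T hT hin hout
  exact hgap r hr ⟨h₁, h₂⟩

/-- **THE ATOM BUDGET LAW.**  Along a dominant chain `p₀ ≺ … ≺ pₙ` with distinct consecutive terms, let `C` be any set of COMPOSITE
steps (each witnessed by an invariant column set separating the changes).  Then `n + 1 + #C ≤ #slopeSet m d`: every composite step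
costs one achievable slope that the chain does not visit. [this cell] -/
theorem chain_add_card_le_card_slopeSet (d : Fin K → ℕ) (v ε : Fin m → Fin m → Fin K → ℤ) {n : ℕ}
    (θ : Fin (n + 1) → ℤ) (p : Fin (n + 1) → Equiv.Perm (Fin m) × (Fin m → Fin K))
    (hθ : StrictMono θ) (hdom : ∀ k, IsDominant d v ε (θ k) (p k)) (hne : ∀ k : Fin n, p k.castSucc ≠ p k.succ)
    (C : Finset (Fin n))
    (hC : ∀ k ∈ C, ∃ T : Finset (Fin m), (∀ b, ((p k.castSucc).1⁻¹ * (p k.succ).1) b ∈ T ↔ b ∈ T) ∧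
      (∃ b ∈ T, (p k.castSucc).1 b ≠ (p k.succ).1 b ∨ (p k.castSucc).2 b ≠ (p k.succ).2 b) ∧
      (∃ b ∉ T, (p k.castSucc).1 b ≠ (p k.succ).1 b ∨ (p k.castSucc).2 b ≠ (p k.succ).2 b)) :
    n + 1 + C.card ≤ (slopeSet m d).card := by
  classical
  -- slopes strictly increase along the chain
  have hsm : StrictMono fun k => TropicalCensus.slope d (p k) := by
    rw [Fin.strictMono_iff_lt_succ]
    intro k
    exact slope_lt_of_dominant d v ε (hθ Fin.castSucc_lt_succ) (hne k) (hdom _) (hdom _)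
  have hmono : ∀ i j : Fin (n + 1), i ≤ j → TropicalCensus.slope d (p i) ≤ TropicalCensus.slope d (p j) :=
    fun i j h => hsm.monotone h
  -- one hybrid slope per composite step
  have hr : ∀ k : C, ∃ r : Equiv.Perm (Fin m) × (Fin m → Fin K),
      TropicalCensus.slope d (p k.1.castSucc) < TropicalCensus.slope d r ∧ TropicalCensus.slope d r < TropicalCensus.slope d (p k.1.succ) := by
    intro k
    obtain ⟨T, hT, hin, hout⟩ := hC k.1 k.2
    obtain ⟨r, -, -, -, h₁, h₂⟩ :=
      exists_present_slope_between d v ε (hθ Fin.castSucc_lt_succ) (hdom _) (hdom _) T hT hin hout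
    exact ⟨r, h₁, h₂⟩
  choose r hr₁ hr₂ using hr
  -- the injection `Fin (n+1) ⊕ C ↪ slopeSet m d`
  let f : Fin (n + 1) ⊕ (C : Set (Fin n)) → slopeSet m d := fun x =>
    match x with
    | Sum.inl k => ⟨TropicalCensus.slope d (p k), slope_mem_slopeSet d (p k)⟩
    | Sum.inr k => ⟨TropicalCensus.slope d (r k), slope_mem_slopeSet d (r k)⟩
  have hf : Function.Injective f := by
    rintro (k | k) (k' | k') h
    · have h' : TropicalCensus.slope d (p k) = TropicalCensus.slope d (p k') := by simpa [f] using congrArg Subtype.val h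
      exact congrArg Sum.inl (hsm.injective h')
    · exfalso
      have h' : TropicalCensus.slope d (p k) = TropicalCensus.slope d (r k') := by simpa [f] using congrArg Subtype.val h
      rcases Nat.lt_or_ge (k : ℕ) ((k'.1 : ℕ) + 1) with hlt | hge
      · have hle : k ≤ k'.1.castSucc := Fin.le_iff_val_le_val.2 (by rw [Fin.val_castSucc]; omega)
        have := hmono _ _ hle
        linarith [hr₁ k']
      · have hle : k'.1.succ ≤ k := Fin.le_iff_val_le_val.2 (by rw [Fin.val_succ]; omega)
        have := hmono _ _ hle
        linarith [hr₂ k']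
    · exfalso
      have h' : TropicalCensus.slope d (r k) = TropicalCensus.slope d (p k') := by simpa [f] using congrArg Subtype.val h
      rcases Nat.lt_or_ge (k' : ℕ) ((k.1 : ℕ) + 1) with hlt | hge
      · have hle : k' ≤ k.1.castSucc := Fin.le_iff_val_le_val.2 (by rw [Fin.val_castSucc]; omega)
        have := hmono _ _ hle
        linarith [hr₁ k]
      · have hle : k.1.succ ≤ k' := Fin.le_iff_val_le_val.2 (by rw [Fin.val_succ]; omega)
        have := hmono _ _ hle
        linarith [hr₂ k]
    · have h' : TropicalCensus.slope d (r k) = TropicalCensus.slope d (r k') := by simpa [f] using congrArg Subtype.val h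
      rcases lt_trichotomy (k.1 : ℕ) (k'.1 : ℕ) with hlt | heq | hgt
      · exfalso
        have hle : k.1.succ ≤ k'.1.castSucc := Fin.le_iff_val_le_val.2 (by rw [Fin.val_succ, Fin.val_castSucc]; omega)
        have := hmono _ _ hle
        linarith [hr₂ k, hr₁ k']
      · exact congrArg Sum.inr (Subtype.ext (Fin.ext heq))
      · exfalso
        have hle : k'.1.succ ≤ k.1.castSucc := Fin.le_iff_val_le_val.2 (by rw [Fin.val_succ, Fin.val_castSucc]; omega)
        have := hmono _ _ hle
        linarith [hr₂ k', hr₁ k]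
  have hcard := Fintype.card_le_of_injective f hf
  simpa [Fintype.card_sum, Fintype.card_fin, Fintype.card_coe] using hcard

/-- the atom budget against the counting ceiling: `n + 1 + #{composite steps} ≤ multichoose K m = C(m+K−1, m)`. [this cell] -/
theorem chain_add_card_le_multichoose (d : Fin K → ℕ) (v ε : Fin m → Fin m → Fin K → ℤ) {n : ℕ}
    (θ : Fin (n + 1) → ℤ) (p : Fin (n + 1) → Equiv.Perm (Fin m) × (Fin m → Fin K))
    (hθ : StrictMono θ) (hdom : ∀ k, IsDominant d v ε (θ k) (p k)) (hne : ∀ k : Fin n, p k.castSucc ≠ p k.succ)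
    (C : Finset (Fin n))
    (hC : ∀ k ∈ C, ∃ T : Finset (Fin m), (∀ b, ((p k.castSucc).1⁻¹ * (p k.succ).1) b ∈ T ↔ b ∈ T) ∧
      (∃ b ∈ T, (p k.castSucc).1 b ≠ (p k.succ).1 b ∨ (p k.castSucc).2 b ≠ (p k.succ).2 b) ∧
      (∃ b ∉ T, (p k.castSucc).1 b ≠ (p k.succ).1 b ∨ (p k.castSucc).2 b ≠ (p k.succ).2 b)) :
    n + 1 + C.card ≤ Nat.multichoose K m :=
  (chain_add_card_le_card_slopeSet d v ε θ p hθ hdom hne C hC).trans (card_slopeSet_le_multichoose d)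

/-- **signed form** (the hypotheses of `TropRow` / `TropRootLawAt`): `n + 1 + #{composite steps} ≤ #slopeSet m d`. [this cell] -/
theorem chain_add_card_le_card_slopeSet_alt (d : Fin K → ℕ) (v ε : Fin m → Fin m → Fin K → ℤ) {n : ℕ}
    (θ : Fin (n + 1) → ℤ) (p : Fin (n + 1) → Equiv.Perm (Fin m) × (Fin m → Fin K))
    (hθ : StrictMono θ) (hdom : ∀ k, IsDominant d v ε (θ k) (p k))
    (halt : ∀ k : Fin n, termSign ε (p k.castSucc) * termSign ε (p k.succ) < 0)
    (C : Finset (Fin n))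
    (hC : ∀ k ∈ C, ∃ T : Finset (Fin m), (∀ b, ((p k.castSucc).1⁻¹ * (p k.succ).1) b ∈ T ↔ b ∈ T) ∧
      (∃ b ∈ T, (p k.castSucc).1 b ≠ (p k.succ).1 b ∨ (p k.castSucc).2 b ≠ (p k.succ).2 b) ∧
      (∃ b ∉ T, (p k.castSucc).1 b ≠ (p k.succ).1 b ∨ (p k.castSucc).2 b ≠ (p k.succ).2 b)) :
    n + 1 + C.card ≤ (slopeSet m d).card :=
  chain_add_card_le_card_slopeSet d v ε θ p hθ hdom (ne_succ_of_alternating ε p halt) C hC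

/-- **COUNTING-TIGHT CHAINS ARE ATOMIC.**  If a dominant chain with distinct consecutive terms exhausts the slope budget
(`#slopeSet m d ≤ n + 1`), then every step moves exactly one orbit of `σ_k⁻¹σ_{k+1}`: for every invariant column set `T`, the
consecutive terms agree (row AND class) on all of `T` or on all of `Tᶜ`. [this cell] -/
theorem atomic_of_card_slopeSet_le (d : Fin K → ℕ) (v ε : Fin m → Fin m → Fin K → ℤ) {n : ℕ}
    (θ : Fin (n + 1) → ℤ) (p : Fin (n + 1) → Equiv.Perm (Fin m) × (Fin m → Fin K))
    (hθ : StrictMono θ) (hdom : ∀ k, IsDominant d v ε (θ k) (p k)) (hne : ∀ k : Fin n, p k.castSucc ≠ p k.succ)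
    (htight : (slopeSet m d).card ≤ n + 1) (k : Fin n) (T : Finset (Fin m))
    (hT : ∀ b, ((p k.castSucc).1⁻¹ * (p k.succ).1) b ∈ T ↔ b ∈ T) :
    (∀ b ∈ T, (p k.castSucc).1 b = (p k.succ).1 b ∧ (p k.castSucc).2 b = (p k.succ).2 b) ∨
    (∀ b ∉ T, (p k.castSucc).1 b = (p k.succ).1 b ∧ (p k.castSucc).2 b = (p k.succ).2 b) := by
  by_contra h
  rw [not_or] at h
  obtain ⟨h1, h2⟩ := h
  have hin : ∃ b ∈ T, (p k.castSucc).1 b ≠ (p k.succ).1 b ∨ (p k.castSucc).2 b ≠ (p k.succ).2 b := by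
    by_contra hc; push Not at hc; exact h1 fun b hb => hc b hb
  have hout : ∃ b ∉ T, (p k.castSucc).1 b ≠ (p k.succ).1 b ∨ (p k.castSucc).2 b ≠ (p k.succ).2 b := by
    by_contra hc; push Not at hc; exact h2 fun b hb => hc b hb
  have := chain_add_card_le_card_slopeSet d v ε θ p hθ hdom hne {k} (fun k' hk' => by
    rw [Finset.mem_singleton] at hk'; subst hk'; exact ⟨T, hT, hin, hout⟩)
  rw [Finset.card_singleton] at this
  omega

/-- **counting-tight chains are atomic, census form**: a sign-alternating dominant chain of format `(m, K)` with
`multichoose K m ≤ n + 1` terms-worth of budget (i.e. `n = C(m+K−1,m) − 1`, the slope-counting ceiling attained) has only atomic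
steps. [this cell] -/
theorem atomic_of_multichoose_le (d : Fin K → ℕ) (v ε : Fin m → Fin m → Fin K → ℤ) {n : ℕ}
    (θ : Fin (n + 1) → ℤ) (p : Fin (n + 1) → Equiv.Perm (Fin m) × (Fin m → Fin K))
    (hθ : StrictMono θ) (hdom : ∀ k, IsDominant d v ε (θ k) (p k))
    (halt : ∀ k : Fin n, termSign ε (p k.castSucc) * termSign ε (p k.succ) < 0)
    (htight : Nat.multichoose K m ≤ n + 1) (k : Fin n) (T : Finset (Fin m))
    (hT : ∀ b, ((p k.castSucc).1⁻¹ * (p k.succ).1) b ∈ T ↔ b ∈ T) :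
    (∀ b ∈ T, (p k.castSucc).1 b = (p k.succ).1 b ∧ (p k.castSucc).2 b = (p k.succ).2 b) ∨
    (∀ b ∉ T, (p k.castSucc).1 b = (p k.succ).1 b ∧ (p k.castSucc).2 b = (p k.succ).2 b) :=
  atomic_of_card_slopeSet_le d v ε θ p hθ hdom (ne_succ_of_alternating ε p halt)
    ((card_slopeSet_le_multichoose d).trans htight) k T hT

end Summit.ValiantsHypothesis.ValiantsHypothesis.Theorems.KPlusLogSqLaw.AtomBudget
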